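import Mathlib
import HarnessLib
import Summits.HubbardSuperconductivity.HubbardSuperconductivity.Theorems.KLProgrammeKLRegimeEngineTowerWtAssemblyKlEngSharp
import Summits.HubbardSuperconductivity.HubbardSuperconductivity.Theorems.KLProgrammeKLRegimeEngineTowerBlockZeroBaseWtKlEngClosed

/-!
# ♯2 RE-KEY («(b)-WT4-BLOCK0-RATE», located by p4 g22 l.11821): block 0's BASE group is asked at the FIXED coupling `λ_d = B·ε_d` (WB3 run once at `lam := B·ε_d` for every
# read-out rate; the unit law lifts to `λ_j` by `λ_d ≤ λ_j`), so `Atot₁` is a real (not rate-indexed) and the group-0 bundle is U-uniformly dischargeable; group 1 unchanged.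
# ♯ RE-KEY («(b)-WT4-READOUT-CE-DIM», located by p4 g22 l.≈11700): the read-out bracket is the SHARP one (`readoutBracket_le_law_mul_sharp`): the `y`-term of `A_tot`
# is divided by `2τQ″` instead of multiplied by `ψ` (ratio `2τψQ″ ∝ (M/β)²`), so `A_tot/ε_x` is `O(1)` in `M/β` and the CE row is M-UNIFORM; nothing else changes.
# Route `KLProgramme` — crux K3 ENGINE (stmt-HubbardSuperconductivity-20437 `KLRegimeEngineV17F2`), stub (b) v2, THE WEIGHTED HALF «(b)-WT4»:
# W9 — «(b)-WT4-ASSEMBLY-∀j», BASE DATUM DISCHARGED: W8 `kernelNormsWt4_all_klEng` with the base rows of `𝒱_d` at `(F_{d−1}, rate j)` supplied by p3 g22's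
# WB2/WB3 (`klTowerMeasWtAt_one_baseRowsW`, `baseLawWtF_blockZero_klEng_closed`, p700691/p701078) — the level-`0` WEIGHTED datum rows of `𝒱_1` at
# `(F_0, rate j)` and block `0`'s own kit numerics take their place
# (cell gate-hubbard-kl, seat hubbard-kl-k3c3-p2 g17; weighted twin of p3's `kernelNormsLevels_all_klEng_final_rows(_closed)` step; E1 may rename or supersede)

W8 asks, for every read-out rate `d ≤ j ≤ n`, a base bound `N_b j p ≥ 0` of the rate-`j` weighted pinned sums of `𝒱_d` at `F_{d−1}` with a unit law
`N_b j p / klLevUnitF β M 0 p (d−1) ≤ A_b·λ_j^{p−1}·Q_b^p` (`p ≥ 3`).  WB2 §1 serves `N_b j p := klTowerMeasWtAt … (K_n) d 1 j (2p)` with `hcar` for free, and WB3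
bounds that carrier by `Atot₁(j)·λ_j^{p−1}·Qtot₁^p` from: `Z^{K_n}_{Λ_1} ≠ 0`, the block-`0` names (`ᾱ₀ := Cα·M/β`, `κ̄₀ := √(2Cκ₀e₀)`, `c̄r₀ c̄c₀`, `W₀ Z₀ σ₀ τ₀ ψ₀ Φ₀`
equational), the level-`0` weighted datum of `𝒱_1` at `(F_0, rate j)` (unit law `A_b₀, Q_b₀`; Chernoff rows `A′₀ Q′₀ ι⁰`), block `0`'s five smallness rows and kit guard
at `λ_j`, and the read-out names `Aro₁ Qro₁ Qtot₁ Atot₁(j)` (equational).  With `Atot₁ j ≤ A_b` (`d ≤ j ≤ n`) and `Q_b := Qtot₁` the base class of W8 is discharged: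
* **`kernelNormsWt4_all_klEng_rows (d R c″)`** — W8's statement with the `Nb` group replaced by the block-`0` group above; head gains WB3's
  `Cinc₁ Dinc₁ ≥ 1`, `Cκ₀ CJ₀ Cα > 0`; conclusion unchanged: `∀ j ≤ n, KernelNormsWt4 L M (klWtBudget P Qe U j) β U μ (klFlowFrameU … n) j`.
REMAINING ROW CLASSES: [p3] `Z^{K_n}_{Λ_1}`, `Z^{K_n}_{Λ_d}`, the low levels `j < d` («WB4»), the level-0 weighted datum rows (supplier class
`kernelNormsWtAt_one_of_doors`, p697771); [E1 via k3c2-p3] imports and cells; [p4] main + block-0 numerics, CE row; [D] caps.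
Compositions of landed theorems; nothing about the model is asserted beyond them; nothing asserts (b), WT4's rows, (ℓ), any stub, K3 or superconductivity.
References: BGM 2006 §2.8 (2.76)–(2.84), (2.93)–(2.98), Lemma 2.5, §3 (3.2)–(3.8) [cite: BenfattoGiulianiMastropietro2006].
-/

noncomputable section

namespace Summit.HubbardSuperconductivity.HubbardSuperconductivity.Theorems.EngineV8

set_option linter.dupNamespace false -- summit = problem name (single-conjunct summit), D-0017

open Classical
open Real Finset Literature.MathematicalPhysics.QuantumLattice Literature.Probability.LatticeModels GrassmannAlgebra
open Literature.MathematicalPhysics.QuantumLattice.FermiRG Literature.MathematicalPhysics.QuantumLattice.FermiRG.BGM2006Routing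
open Summit.HubbardSuperconductivity.HubbardSuperconductivity.Theorems.KLProgrammeLegKernels
open Summit.HubbardSuperconductivity.HubbardSuperconductivity.Theorems.KLRegimeSplit
open Summit.HubbardSuperconductivity.HubbardSuperconductivity.Theorems.KLRegimeWick
open Summit.HubbardSuperconductivity.HubbardSuperconductivity.Theorems.TwoPointAssembly
open Summit.HubbardSuperconductivity.HubbardSuperconductivity.Theorems.DispersionFlow
open Summit.HubbardSuperconductivity.HubbardSuperconductivity.Theorems.TorusFourierL2

variable {L M : ℕ} [NeZero L] [NeZero M]

/-! ## The weighted clause at every level, base datum discharged -/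

/-- **STUB (b)'s WEIGHTED CLAUSE ON THE FLOW FRAME — ASSEMBLY WITH THE BASE DATUM DISCHARGED** (see the module docstring); conclusion
`∀ j ≤ n, KernelNormsWt4 L M (klWtBudget P Qe U j) β U μ (klFlowFrameU L M β U μ n) j`.
[cite: BenfattoGiulianiMastropietro2006, §2.8 (2.76)-(2.84), (2.93)-(2.98), Lemma 2.5 (2.98), §3 (3.2)-(3.8)] -/
theorem kernelNormsWt4_all_klEng_rows_sharp2 (d : ℕ) (R : RenConsts) (c'' : ℝ) (hc'' : 0 < c'') :
    ∃ C₁ C₂ Cκ Cb CJ C₁r C₂r Cκr Cbr CJr C₁i C₂i : ℝ, 0 < C₁ ∧ 0 < C₂ ∧ 0 < Cκ ∧ 0 < Cb ∧ 0 < CJ ∧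
      0 < C₁r ∧ 0 < C₂r ∧ 0 < Cκr ∧ 0 < Cbr ∧ 0 < CJr ∧ 0 < C₁i ∧ 0 < C₂i ∧
      ∃ Cinc₁ Dinc₁ : ℝ, 1 ≤ Cinc₁ ∧ 1 ≤ Dinc₁ ∧ ∃ Cκ₀ CJ₀ Cα : ℝ, 0 < Cκ₀ ∧ 0 < CJ₀ ∧ 0 < Cα ∧
      (R.WF2 → ∃ c₃' : ℝ, 0 < c₃' ∧ ∃ U₀' : ℝ, 0 < U₀' ∧
      ∀ (G : GeoConsts) (P : SplitConsts) (Q : EngConsts) (c : ℝ), P.WF → 0 < c → c ≤ klEngC₃6 P R → c ≤ c₃' →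
      ∀ μ ∈ klWindowC, ∀ U : ℝ, 0 < U → U ≤ klEngU₀9 P R c → U ≤ U₀' → c'' * U ≤ 1 →
      ∀ β : ℝ, klBetaMin ≤ β → β ≤ Real.exp (c / U ^ 2) →
      ∀ (L M : ℕ) [NeZero L] [NeZero M], klEngL₃ β U ≤ L → klEngM₃ β U L ≤ M →
      ∀ n : ℕ, 1 ≤ n → n ≤ nScales β + 1 → IsKLRegime U c (-(n : ℤ)) → HistP klPredsV17F2 L M G P Q R β U μ 0 n →
        (∀ m', 1 ≤ m' → m' < n → FlowPieceOscAt L M c'' β U μ m') →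
      2 ≤ d → d ≤ n →
      -- the degree caps [choice: `exists_degreeCap`] (+ block `0`'s input family `F_0`)
      ∀ D : ℕ, 3 ≤ D → (∀ k, 1 ≤ k → d * k ≤ n → Fintype.card (SpaceTimeIdx L M × SectorLeg (sectorCount (d * k - 1))) / 2 ≤ D) →
        Fintype.card (HubbardFieldIdx L M) ≤ 2 * D + 1 → Fintype.card (SpaceTimeIdx L M × SectorLeg (sectorCount 0)) / 2 ≤ D →
      -- the coupling amplitude and the law's constants
      ∀ (B A Q' Ab Qb : ℝ), 1 ≤ B → 0 ≤ A → 0 < Q' → 0 ≤ Ab → 0 ≤ Qb →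
      -- BLOCK 0 (p3 WB3): the two partition functions, the block-0 names, the level-0 weighted datum of `𝒱_1` at `(F_0, rate j)`, block 0's numerics
      hubbardEffPartitionFnCT L M β U μ 0 (klFlowFrameU L M β U μ n) (klScale klE0 1) ≠ 0 →
      hubbardEffPartitionFnCT L M β U μ 0 (klFlowFrameU L M β U μ n) (klScale klE0 d) ≠ 0 →
      ∀ (Ab₀ Qb₀ : ℝ), 0 ≤ Ab₀ → 0 ≤ Qb₀ →
      ∀ (αb₀ κb₀ crb₀ ccb₀ W₀ Z₀ σ₀ τ₀ ψ₀ Φ₀ : ℝ), αb₀ = Cα * ((M : ℝ) / β) → κb₀ = Real.sqrt (2 * Cκ₀ * klE0) → crb₀ = 81 * CJ₀ * M / β →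
        ccb₀ = 162 * CJ₀ * M / β → W₀ = 32 * crb₀ / ccb₀ → Z₀ = imagTimeWeight β M ^ 2 * ccb₀ ^ 2 / 8 → σ₀ = κb₀ ^ 2 / ccb₀ ^ 2 →
        τ₀ = 4 * exp 4 * κb₀ ^ 2 / ccb₀ ^ 2 → ψ₀ = ccb₀ ^ 2 / κb₀ ^ 2 → Φ₀ = exp 1 * αb₀ * ccb₀ / (κb₀ ^ 2 * crb₀) →
      ∀ (A'₀ Q'₀ ι₁₀ ι₂₀ ι₃₀ : ℝ), 0 ≤ A'₀ → 0 < Q'₀ →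
      (∀ j, d ≤ j → j ≤ n → ∀ p : ℕ, 3 ≤ p →
        klTowerMeasWtAt L M β U μ (klFlowFrameU L M β U μ n) 1 1 j (2 * p) / klLevUnitF β M 0 p 0 ≤ Ab₀ * (B * epsCoupling P U d) ^ (p - 1) * Qb₀ ^ p) →
      (∀ j, d ≤ j → j ≤ n →
        (∀ m, 4 ≤ m → m ≤ D → W₀ * Z₀ ^ m * (klTowerMeasWtAt L M β U μ (klFlowFrameU L M β U μ n) 1 1 j (2 * m) / klLevUnitF β M 0 m 0) ≤
          A'₀ * (B * epsCoupling P U d) ^ (m - 1) * Q'₀ ^ m) ∧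
        W₀ * Z₀ ^ 3 * (klTowerMeasWtAt L M β U μ (klFlowFrameU L M β U μ n) 1 1 j (2 * 3) / klLevUnitF β M 0 3 0) ≤ ι₃₀ * (B * epsCoupling P U d) ^ 2 ∧
        W₀ * Z₀ ^ 1 * (klTowerMeasWtAt L M β U μ (klFlowFrameU L M β U μ n) 1 1 j (2 * 1) / klLevUnitF β M 0 1 0) ≤ ι₁₀ * (B * epsCoupling P U d) ∧
        W₀ * Z₀ ^ 2 * (klTowerMeasWtAt L M β U μ (klFlowFrameU L M β U μ n) 1 1 j (2 * 2) / klLevUnitF β M 0 2 0) ≤ ι₂₀ * (B * epsCoupling P U d) ∧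
        4 * σ₀ * (B * epsCoupling P U d) * Q'₀ < 1 ∧ 2 * (B * epsCoupling P U d) * τ₀ * Q'₀ ≤ 1 ∧ exp 1 * τ₀ * (B * epsCoupling P U d) * Q'₀ < 1 ∧
        Φ₀ * (τ₀ * (ι₁₀ * (B * epsCoupling P U d) + ι₂₀ / (2 * Q'₀) + ι₃₀ / (4 * Q'₀ ^ 2) + A'₀ * Q'₀ / 4)) < 1 ∧
        Φ₀ * (exp 1 * τ₀ * (ι₁₀ * (B * epsCoupling P U d)) + (exp 1 * τ₀) ^ 2 * (ι₂₀ * (B * epsCoupling P U d)) +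
          (exp 1 * τ₀) ^ 3 * (ι₃₀ * (B * epsCoupling P U d) ^ 2) +
          A'₀ * (exp 1 * τ₀ * Q'₀) * ((exp 1 * τ₀ * (B * epsCoupling P U d) * Q'₀) ^ 3 / (1 - exp 1 * τ₀ * (B * epsCoupling P U d) * Q'₀))) < 1 ∧
        Φ₀ * towerV D τ₀ (fun m => W₀ * Z₀ ^ m *
          (klTowerMeasWtAt L M β U μ (klFlowFrameU L M β U μ n) 1 1 j (2 * m) / klLevUnitF β M 0 m 0)) < 1) →
      ∀ (Aro₁ Qro₁ Qtot₁ Atot₁ : ℝ), Aro₁ = Cinc₁ * Ab₀ → Qro₁ = Dinc₁ * Qb₀ →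
        Qtot₁ = Dinc₁ * max 1 (max Qro₁ (max (4 * Q'₀) (2 * τ₀ * ψ₀ * Q'₀))) →
        (Atot₁ = Aro₁ + Cinc₁ * (A'₀ * (4 * σ₀ * (B * epsCoupling P U d) * Q'₀ / (1 - 4 * σ₀ * (B * epsCoupling P U d) * Q'₀)) +
          exp 1 * (τ₀ * (ι₁₀ * (B * epsCoupling P U d) + ι₂₀ / (2 * Q'₀) + ι₃₀ / (4 * Q'₀ ^ 2) + A'₀ * Q'₀ / 4)) *
            (Φ₀ * (τ₀ * (ι₁₀ * (B * epsCoupling P U d) + ι₂₀ / (2 * Q'₀) + ι₃₀ / (4 * Q'₀ ^ 2) + A'₀ * Q'₀ / 4)) /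
              (1 - Φ₀ * (τ₀ * (ι₁₀ * (B * epsCoupling P U d) + ι₂₀ / (2 * Q'₀) + ι₃₀ / (4 * Q'₀ ^ 2) + A'₀ * Q'₀ / 4)))) / (2 * τ₀ * Q'₀))) →
        (d ≤ n → Atot₁ ≤ Ab) → Qtot₁ = Qb →
      -- dominants of the LINK's and of the read-out's constants, and the names
      ∀ (κb αb crb ccb : ℝ), Real.sqrt (2 * Cκ * klE0) ≤ κb → Cb * ((M : ℝ) / β) * (4 : ℝ) ^ d / klE0 ≤ αb →
        81 * CJ * M / β ≤ crb → 162 * CJ * M / β ≤ ccb →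
        Real.sqrt (2 * Cκr * klE0) ≤ κb → Cbr * ((M : ℝ) / β) * (4 : ℝ) ^ d / klE0 ≤ αb → 81 * CJr * M / β ≤ crb → 162 * CJr * M / β ≤ ccb →
      ∀ (W Z σ τ ψ Φ : ℝ),
        W = 32 * crb / ccb → Z = imagTimeWeight β M ^ 2 * ccb ^ 2 / 8 →
        σ = κb ^ 2 / ccb ^ 2 → τ = 4 * exp 4 * κb ^ 2 / ccb ^ 2 → ψ = ccb ^ 2 / κb ^ 2 → Φ = exp 1 * αb * ccb / (κb ^ 2 * crb) →
      ∀ (A' Q'' : ℝ),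
        W * ((C₁ / C₂) * (8 : ℝ) ^ (d - 1) * (Ab + A / (1 - ((2 : ℝ) ^ d)⁻¹))) ≤ A' →
        Z * (C₂ ^ 2 * ((2 : ℝ) ^ (d - 1))⁻¹ * max Q' Qb) ≤ Q'' → W * Ab ≤ A' → Z * Qb ≤ Q'' → 0 < Q'' →
      -- the weighted imports at every block `d·k ≤ j`, every rate `d ≤ j ≤ n` [E1 via k3c2-p3 `importBindersWt_of_wplainLines_flow_all`]
      ∀ (ι₁ ι₂ ι₃ : ℝ),
      (∀ j, d ≤ j → j ≤ n → ∀ k, 1 ≤ k → d * k ≤ j → W * Z ^ 1 *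
        (klTowerMeasWtAt L M β U μ (klFlowFrameU L M β U μ n) d k j (2 * 1) / klLevUnitF β M 0 1 (d * k - 1)) ≤ ι₁ * (B * epsCoupling P U j)) →
      (∀ j, d ≤ j → j ≤ n → ∀ k, 1 ≤ k → d * k ≤ j → W * Z ^ 2 *
        (klTowerMeasWtAt L M β U μ (klFlowFrameU L M β U μ n) d k j (2 * 2) / klLevUnitF β M 0 2 (d * k - 1)) ≤ ι₂ * (B * epsCoupling P U j)) →
      (∀ j, d ≤ j → j ≤ n → ∀ k, 1 ≤ k → d * k ≤ j → W * Z ^ 3 *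
        (klTowerMeasWtAt L M β U μ (klFlowFrameU L M β U μ n) d k j (2 * 3) / klLevUnitF β M 0 3 (d * k - 1)) ≤ ι₃ * (B * epsCoupling P U j) ^ 2) →
      -- the kit's numerics at every read-out rate [p4 «part 4»]
      (∀ j, d ≤ j → j ≤ n →
        4 * σ * (B * epsCoupling P U j) * Q'' < 1 ∧ 2 * (B * epsCoupling P U j) * τ * Q'' ≤ 1 ∧ exp 1 * τ * (B * epsCoupling P U j) * Q'' < 1 ∧
        Φ * (τ * (ι₁ * (B * epsCoupling P U j) + ι₂ / (2 * Q'') + ι₃ / (4 * Q'' ^ 2) + A' * Q'' / 4)) < 1 ∧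
        Φ * (exp 1 * τ * (ι₁ * (B * epsCoupling P U j)) + (exp 1 * τ) ^ 2 * (ι₂ * (B * epsCoupling P U j)) +
          (exp 1 * τ) ^ 3 * (ι₃ * (B * epsCoupling P U j) ^ 2) +
          A' * (exp 1 * τ * Q'') * ((exp 1 * τ * (B * epsCoupling P U j) * Q'') ^ 3 / (1 - exp 1 * τ * (B * epsCoupling P U j) * Q''))) < 1 ∧
        4 * Q'' ≤ Q' ∧ 2 * τ * ψ * Q'' ≤ Q' ∧
        A' * (4 * Q'') ^ 3 * (4 * σ * (B * epsCoupling P U j) * Q'' / (1 - 4 * σ * (B * epsCoupling P U j) * Q'')) +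
          exp 1 * ψ * (2 * τ * ψ * Q'') ^ 2 * (τ * (ι₁ * (B * epsCoupling P U j) + ι₂ / (2 * Q'') + ι₃ / (4 * Q'' ^ 2) + A' * Q'' / 4)) *
            (Φ * (τ * (ι₁ * (B * epsCoupling P U j) + ι₂ / (2 * Q'') + ι₃ / (4 * Q'' ^ 2) + A' * Q'' / 4)) /
              (1 - Φ * (τ * (ι₁ * (B * epsCoupling P U j) + ι₂ / (2 * Q'') + ι₃ / (4 * Q'' ^ 2) + A' * Q'' / 4)))) ≤ A * Q' ^ 3) →
      -- the read-out constants level by level and the budget package's `CE` row [p4]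
      ∀ (Qe : EngConsts) (Atot Qtot : ℕ → ℝ),
        (∀ j, Qtot j = max 1 (C₂i ^ 2) * max 1 (max (C₂r ^ 2 * max Q' Qb) (max (4 * Q'') (2 * τ * ψ * Q'')))) →
        (∀ j, Atot j = C₁r / C₂r * (Ab + A) + C₁i / C₂i * (A' * (4 * σ * (B * epsCoupling P U j) * Q'' / (1 - 4 * σ * (B * epsCoupling P U j) * Q'')) +
          exp 1 * (τ * (ι₁ * (B * epsCoupling P U j) + ι₂ / (2 * Q'') + ι₃ / (4 * Q'' ^ 2) + A' * Q'' / 4)) *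
            (Φ * (τ * (ι₁ * (B * epsCoupling P U j) + ι₂ / (2 * Q'') + ι₃ / (4 * Q'' ^ 2) + A' * Q'' / 4)) /
              (1 - Φ * (τ * (ι₁ * (B * epsCoupling P U j) + ι₂ / (2 * Q'') + ι₃ / (4 * Q'' ^ 2) + A' * Q'' / 4)))) / (2 * τ * Q''))) →
        (∀ j, d ≤ j → j ≤ n → Qtot j * imagTimeWeight β M ^ 2 * B * max 1 (Atot j / imagTimeWeight β M) ≤ Qe.CE) → 0 ≤ Qe.CE →
      -- the two import cells at every level [E1 via k3c2-p3 `klWtPinnedSum_four/_six_le_of_wplain_flow_all`] and the low levels [p3 block-0 class]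
      (∀ j, j ≤ n → ∀ (q : Fin 4) (w : SpaceTimeIdx L M × SectorLeg (sectorCount j)),
        klWtPinnedSum L M β U μ (klFlowFrameU L M β U μ n) j 4 q w ≤ klWtBudget P Qe U j 4) →
      (∀ j, j ≤ n → ∀ (q : Fin 6) (w : SpaceTimeIdx L M × SectorLeg (sectorCount j)),
        klWtPinnedSum L M β U μ (klFlowFrameU L M β U μ n) j 6 q w ≤ klWtBudget P Qe U j 6) →
      (∀ j, j < d → j ≤ n → KernelNormsWt4 L M (klWtBudget P Qe U j) β U μ (klFlowFrameU L M β U μ n) j) →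
      ∀ j, j ≤ n → KernelNormsWt4 L M (klWtBudget P Qe U j) β U μ (klFlowFrameU L M β U μ n) j) := by
  obtain ⟨C₁, C₂, Cκ, Cb, CJ, C₁r, C₂r, Cκr, Cbr, CJr, C₁i, C₂i, hC₁, hC₂, hCκ, hCb, hCJ, hC₁r, hC₂r, hCκr, hCbr, hCJr, hC₁i, hC₂i, hall⟩ :=
    kernelNormsWt4_all_klEng_sharp d R c'' hc''
  obtain ⟨Cinc₁, Dinc₁, hCinc₁, hDinc₁, Cκ₀, CJ₀, Cα, hCκ₀, hCJ₀, hCα, hbase⟩ := baseLawWtF_blockZero_klEng_closed d R c'' hc''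
  refine ⟨C₁, C₂, Cκ, Cb, CJ, C₁r, C₂r, Cκr, Cbr, CJr, C₁i, C₂i, hC₁, hC₂, hCκ, hCb, hCJ, hC₁r, hC₂r, hCκr, hCbr, hCJr, hC₁i, hC₂i,
    Cinc₁, Dinc₁, hCinc₁, hDinc₁, Cκ₀, CJ₀, Cα, hCκ₀, hCJ₀, hCα, fun hR2 => ?_⟩
  obtain ⟨c₃a, hc₃a, U₀a, hU₀a, hall'⟩ := hall hR2
  obtain ⟨c₃b, hc₃b, U₀b, hU₀b, hbase'⟩ := hbase hR2
  refine ⟨min c₃a c₃b, lt_min hc₃a hc₃b, min U₀a U₀b, lt_min hU₀a hU₀b, ?_⟩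
  intro G P Q c hP hc hc6 hc₃' μ hμ U hU hU9 hU₀' hcU β hβmin hβc L M _ _ hL3 hM3 n hn1 hnN hkl hhist hosc hd hdn D hD3 hD hcard hD0
    B A Q' Ab Qb hB hA hQ hAb hQb hZ1 hZd Ab₀ Qb₀ hAb₀ hQb₀ αb₀ κb₀ crb₀ ccb₀ W₀ Z₀ σ₀ τ₀ ψ₀ Φ₀ hαb₀ hκb₀ hcrb₀ hccb₀ hW₀ hZ₀ hσ₀ hτ₀ hψ₀ hΦ₀
    A'₀ Q'₀ ι₁₀ ι₂₀ ι₃₀ hA'₀ hQ'₀ hlawb₀ hblk0 Aro₁ Qro₁ Qtot₁ Atot₁ hAro₁ hQro₁ hQtot₁ hAtot₁ hAtotle hQtotQb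
    κb αb crb ccb hκb hαb hcrb hccb hκbr hαbr hcrbr hccbr W Z σ τ ψ Φ hW hZ' hσ hτ hψ hΦ
    A' Q'' hA'1 hQ'1 hA'2 hQ'2 hQ'0 ι₁ ι₂ ι₃ hι₁ hι₂ hι₃ hnum Qe Atot Qtot hQtot hAtot hCE hCE0 hcell4 hcell6 hlow
  obtain ⟨hc₃a', hc₃b'⟩ : c ≤ c₃a ∧ c ≤ c₃b := le_min_iff.1 hc₃'
  obtain ⟨hU₀a', hU₀b'⟩ : U ≤ U₀a ∧ U ≤ U₀b := le_min_iff.1 hU₀'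
  have hβ : 0 < β := KLRegimeSplit.pos_of_klBetaMin_le hβmin
  have hK1 : 1 ≤ P.Klam := hP.1
  have hKl : 0 ≤ P.Klam := le_trans zero_le_one hK1
  have hfr : FrameOK R U (nScales β) μ (klFlowFrameU L M β U μ n) := frameOK_klFlowFrameU_of_histP_le hR2 hn1 le_rfl hnN hhist
  set K : TrigPolyC4v := klFlowFrameU L M β U μ n with hKdef
  -- the base rows from WB2/WB3
  set Nb : ℕ → ℕ → ℝ := fun j p => klTowerMeasWtAt L M β U μ K d 1 j (2 * p) with hNb
  have hNb0 : ∀ j p, 0 ≤ Nb j p := fun j p => (klTowerMeasWtAt_one_baseRowsW hβ.le U μ K d j).1 p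
  have hcar : ∀ j, d ≤ j → j ≤ n → ∀ (p : ℕ) (q : Fin (2 * p)) (w' : SpaceTimeIdx L M × SectorLeg (sectorCount (d - 1))),
      klWtPinnedSumAt L M β μ K (d - 1) j (2 * p) (klTowerInput L M β U μ K d 1) q w' ≤ Nb j p :=
    fun j _ _ p q w' => (klTowerMeasWtAt_one_baseRowsW hβ.le U μ K d j).2 p q w'
  have hlawb : ∀ j, d ≤ j → j ≤ n → ∀ p : ℕ, 3 ≤ p → Nb j p / klLevUnitF β M 0 p (d - 1) ≤ Ab * (B * epsCoupling P U j) ^ (p - 1) * Qb ^ p := by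
    intro j hjd hjn p hp
    have hεpos : 0 < epsCoupling P U d := by
      unfold epsCoupling; have : 0 < P.Klam := by linarith
      positivity
    have hlam : 0 < B * epsCoupling P U d := by positivity
    have hεmono : epsCoupling P U d ≤ epsCoupling P U j := by
      unfold epsCoupling
      exact mul_le_mul_of_nonneg_left ((add_le_add_iff_left |U|).2 (mul_le_mul_of_nonneg_left (Nat.cast_le.2 hjd) (sq_nonneg U))) hKl
    have hlle : B * epsCoupling P U d ≤ B * epsCoupling P U j := mul_le_mul_of_nonneg_left hεmono (zero_le_one.trans hB)
    obtain ⟨hprof₀, hprof3₀, himp₁₀, himp₂₀, hx₁₀, hx₂₀, hx₃₀, hy₀, hθ₀, hguard₀⟩ := hblk0 j hjd hjn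
    have h := hbase' G P Q c hP hc hc6 hc₃b' μ hμ U hU hU9 hU₀b' hcU β hβmin hβc L M hL3 hM3 n hn1 hnN hkl hhist hfr hosc hd hdn hZ1 j D (by omega) hD0
      (B * epsCoupling P U d) Ab₀ Qb₀ hlam hAb₀ hQb₀ αb₀ κb₀ crb₀ ccb₀ W₀ Z₀ σ₀ τ₀ ψ₀ Φ₀ hαb₀ hκb₀ hcrb₀ hccb₀ hW₀ hZ₀ hσ₀ hτ₀ hψ₀ hΦ₀
      A'₀ Q'₀ ι₁₀ ι₂₀ ι₃₀ hA'₀ hQ'₀ (hlawb₀ j hjd hjn) hprof₀ hprof3₀ himp₁₀ himp₂₀ hx₁₀ hx₂₀ hx₃₀ hy₀ hθ₀ hguard₀ Aro₁ Qro₁ Qtot₁ Atot₁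
      hAro₁ hQro₁ hQtot₁ hAtot₁ p hp
    refine h.trans ?_
    have hQtot0 : 0 ≤ Qtot₁ := by rw [hQtotQb]; exact hQb
    rw [hQtotQb]
    calc Atot₁ * (B * epsCoupling P U d) ^ (p - 1) * Qb ^ p ≤ Ab * (B * epsCoupling P U d) ^ (p - 1) * Qb ^ p :=
          mul_le_mul_of_nonneg_right (mul_le_mul_of_nonneg_right (hAtotle hdn) (pow_nonneg hlam.le _)) (pow_nonneg hQb _)
      _ ≤ Ab * (B * epsCoupling P U j) ^ (p - 1) * Qb ^ p :=
          mul_le_mul_of_nonneg_right (mul_le_mul_of_nonneg_left (pow_le_pow_left₀ hlam.le hlle _) hAb) (pow_nonneg hQb _)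
  exact hall' G P Q c hP hc hc6 hc₃a' μ hμ U hU hU9 hU₀a' hcU β hβmin hβc L M hL3 hM3 n hn1 hnN hkl hhist hosc hd D hD3 hD hcard
    B A Q' Ab Qb hB hA hQ hAb hQb Nb hNb0 hcar hlawb hZd κb αb crb ccb hκb hαb hcrb hccb hκbr hαbr hcrbr hccbr W Z σ τ ψ Φ hW hZ' hσ hτ hψ hΦ
    A' Q'' hA'1 hQ'1 hA'2 hQ'2 hQ'0 ι₁ ι₂ ι₃ hι₁ hι₂ hι₃ hnum Qe Atot Qtot hQtot hAtot hCE hCE0 hcell4 hcell6 hlow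

end Summit.HubbardSuperconductivity.HubbardSuperconductivity.Theorems.EngineV8

end
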